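import Summits.ABC.ABC.Theses.IneffectiveSubspace

/-!
# `UniformSadicTowerFour` (stmt-ABC-14937), line `flat-steep-split`: the boundary cell `θ = 1` of the heavy stub

`HeavyPlacesReductions` showed that the heavy-places stub of the line lives on `θ ∈ (0, 1]` (the range
`θ > 1` is vacuous).  This file identifies its BOUNDARY `θ = 1` exactly: a prime `p` with
`c ≤ p^{v_p(abc)}` must have its block equal to `c`, so `p ∤ ab`, `c = p^k` and `S = {p}`
(`heavyOne_structure`, `heavyOne_eq`), and the mixed radical at `S = {p}` is `p · rad₄(ab)`
(`mixed_singleton_primePow`).  Hence (`heavyAtOne_iff_primePowerCell`) the `θ = 1` instance of the core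
stub is EQUIVALENT to the UNIFORM PRIME-POWER CELL at level four:

  `∀ ε > 0 ∃ C ∀ p prime ∀ coprime positive a + b = p^k :  p^k < C · (p · rad₄(ab))^(1+ε)`,

`rad₄(N) = ∏_{q ∣ N} q^⌈v_q(N)/4⌉` — abc for the triples with prime-power `c`, the place `p` discounted
to one factor `p`, the constant free of `p` (compare the route's crux #3 `PrimePowerRadical`: per `q`,
`a = 1`, full radical).  Non-trivial exactly for `k ≥ 2` (at `k = 1` the factor `p = c` pays alone).
This is the first non-vacuous cell of `HeavyPlacesFour` as `θ` decreases from the vacuous range.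
-/

-- `Summit.<Summit>.<Problem>` is the mandated summit-side namespace (CONVENTIONS §2); for the
-- single-conjunct summit `ABC` the two coincide, so the duplicate `ABC.ABC` is deliberate.
set_option linter.dupNamespace false

namespace Summit.ABC.ABC.Theorems.UniformSadicTowerFour.HeavyPlaces

open Literature.NumberTheory.DiophantineGeometry (IsABCTriple)
open scoped BigOperators

/-- **Structure of a 1-heavy prime.** If `c ≤ p^{v_p(abc)}` for an abc triple, then `p ∤ a`, `p ∤ b`,
`v_p(abc) = v_p(c)` and `c = p^{v_p(c)}` with `v_p(c) ≥ 1`. [folklore] -/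
theorem heavyOne_structure {a b c : ℕ} (h : IsABCTriple a b c) {p : ℕ} (hp : p.Prime)
    (hheavy : c ≤ p ^ (a * b * c).factorization p) :
    ¬ p ∣ a ∧ ¬ p ∣ b ∧ (a * b * c).factorization p = c.factorization p ∧
      c = p ^ c.factorization p ∧ 1 ≤ c.factorization p := by
  obtain ⟨ha, hb, hsum, hcop⟩ := h
  have hc : 0 < c := by omega
  have hfac : (a * b * c).factorization p =
      a.factorization p + b.factorization p + c.factorization p := by
    rw [Nat.factorization_mul (by positivity) hc.ne', Nat.factorization_mul ha.ne' hb.ne']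
    rfl
  by_cases hpa : p ∣ a
  · exfalso
    have hpb : ¬ p ∣ b := fun hpb => hp.one_lt.ne' (Nat.eq_one_of_dvd_coprimes hcop hpa hpb)
    have hpc : ¬ p ∣ c := fun hpc => hpb ((Nat.dvd_add_right hpa).mp (hsum ▸ hpc))
    rw [hfac, Nat.factorization_eq_zero_of_not_dvd hpb, Nat.factorization_eq_zero_of_not_dvd hpc,
      add_zero, add_zero] at hheavy
    have := Nat.ordProj_le p ha.ne'
    omega
  by_cases hpb : p ∣ b
  · exfalso
    have hpc : ¬ p ∣ c := fun hpc => hpa ((Nat.dvd_add_left hpb).mp (hsum ▸ hpc))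
    rw [hfac, Nat.factorization_eq_zero_of_not_dvd hpa, Nat.factorization_eq_zero_of_not_dvd hpc,
      zero_add, add_zero] at hheavy
    have := Nat.ordProj_le p hb.ne'
    omega
  have hv : (a * b * c).factorization p = c.factorization p := by
    rw [hfac, Nat.factorization_eq_zero_of_not_dvd hpa, Nat.factorization_eq_zero_of_not_dvd hpb,
      zero_add, zero_add]
  rw [hv] at hheavy
  have hceq : c = p ^ c.factorization p := le_antisymm hheavy (Nat.ordProj_le p hc.ne')
  refine ⟨hpa, hpb, hv, hceq, ?_⟩
  by_contra h0
  have h0' : c.factorization p = 0 := by omega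
  rw [h0', pow_zero] at hceq
  omega

/-- Two 1-heavy primes of the same triple coincide (`c = p^k = p'^{k'}` with `k ≥ 1`). [folklore] -/
theorem heavyOne_eq {a b c : ℕ} (h : IsABCTriple a b c) {p p' : ℕ} (hp : p.Prime) (hp' : p'.Prime)
    (hheavy : c ≤ p ^ (a * b * c).factorization p)
    (hheavy' : c ≤ p' ^ (a * b * c).factorization p') : p = p' := by
  obtain ⟨-, -, -, hceq, hk⟩ := heavyOne_structure h hp hheavy
  obtain ⟨-, -, -, hceq', -⟩ := heavyOne_structure h hp' hheavy'
  have hpc : p ∣ c := by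
    rw [hceq]; exact dvd_pow_self p (by omega)
  rw [hceq'] at hpc
  exact (Nat.prime_dvd_prime_iff_eq hp hp').mp (hp.dvd_of_dvd_pow hpc)

/-- **The mixed radical at a discounted prime power.** If `p ∤ a`, `p ∤ b` and `c = p^k` with `k ≥ 1`,
then `M_{{p}}(abc) = p · rad₄(ab)`. [folklore] -/
theorem mixed_singleton_primePow {a b c p k : ℕ} (ha : a ≠ 0) (hb : b ≠ 0) (hp : p.Prime)
    (hpa : ¬ p ∣ a) (hpb : ¬ p ∣ b) (hc : c = p ^ k) (hk : 1 ≤ k) :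
    (∏ q ∈ ({p} : Finset ℕ), q) *
        ∏ q ∈ (a * b * c).primeFactors \ {p}, q ^ (((a * b * c).factorization q + 3) / 4) =
      p * ∏ q ∈ (a * b).primeFactors, q ^ (((a * b).factorization q + 3) / 4) := by
  have hab : a * b ≠ 0 := Nat.mul_ne_zero ha hb
  have hc0 : c ≠ 0 := by rw [hc]; exact pow_ne_zero _ hp.ne_zero
  have hpab : ¬ p ∣ a * b := fun hdiv => (hp.dvd_mul.mp hdiv).elim hpa hpb
  -- prime factors: `supp(ab·p^k) ∖ {p} = supp(ab)`
  have hset : (a * b * c).primeFactors \ {p} = (a * b).primeFactors := by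
    rw [Nat.primeFactors_mul hab hc0, hc, Nat.primeFactors_prime_pow (by omega) hp]
    ext q
    simp only [Finset.mem_sdiff, Finset.mem_union, Finset.mem_singleton]
    constructor
    · rintro ⟨hq | hq, hne⟩
      · exact hq
      · exact absurd hq hne
    · intro hq
      refine ⟨Or.inl hq, fun hqp => hpab ?_⟩
      rw [← hqp]; exact Nat.dvd_of_mem_primeFactors hq
  -- exponents: for `q ∣ ab`, `v_q(ab·c) = v_q(ab)` (`q ≠ p`)
  have hexp : ∀ q ∈ (a * b).primeFactors,
      (a * b * c).factorization q = (a * b).factorization q := by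
    intro q hq
    have hqP : q.Prime := Nat.prime_of_mem_primeFactors hq
    have hqp : q ≠ p := fun hqp => hpab (hqp ▸ Nat.dvd_of_mem_primeFactors hq)
    rw [Nat.factorization_mul hab hc0, Finsupp.add_apply, hc, hp.factorization_pow,
      Finsupp.single_apply, if_neg hqp.symm, add_zero]
  rw [Finset.prod_singleton, hset]
  congr 1
  exact Finset.prod_congr rfl fun q hq => by rw [hexp q hq]

/-- **The boundary cell `θ = 1` of the heavy stub is the uniform prime-power cell at level four.**
[folklore] -/
theorem heavyAtOne_iff_primePowerCell :
    (∀ ε : ℝ, 0 < ε → ∃ C : ℝ, 0 < C ∧ ∀ S : Finset ℕ, S.Nonempty →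
      (∀ p ∈ S, Nat.Prime p) → ∀ a b c : ℕ, IsABCTriple a b c →
      (∀ p ∈ S, (c : ℝ) ^ (1 : ℝ) ≤ ((p ^ (a * b * c).factorization p : ℕ) : ℝ)) →
      (c : ℝ) < C * ((((∏ p ∈ S, p) *
        ∏ p ∈ (a * b * c).primeFactors \ S, p ^ (((a * b * c).factorization p + 3) / 4) : ℕ) : ℝ)) ^
          (1 + ε)) ↔
    (∀ ε : ℝ, 0 < ε → ∃ C : ℝ, 0 < C ∧ ∀ p a b k : ℕ, p.Prime → IsABCTriple a b (p ^ k) →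
      ((p ^ k : ℕ) : ℝ) < C * ((p * ∏ q ∈ (a * b).primeFactors,
        q ^ (((a * b).factorization q + 3) / 4) : ℕ) : ℝ) ^ (1 + ε)) := by
  constructor
  · -- heavy at `θ = 1` ⟹ prime-power cell: take `S = {p}`
    intro h ε hε
    obtain ⟨C, hC, hS⟩ := h ε hε
    refine ⟨C, hC, fun p a b k hp habc => ?_⟩
    have habc' := habc
    obtain ⟨ha, hb, hsum, hcop⟩ := habc'
    have hk : 1 ≤ k := by
      by_contra h0
      have : k = 0 := by omega
      subst this
      simp at hsum; omega
    have hpa : ¬ p ∣ a := by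
      intro hpa
      have hpb : ¬ p ∣ b := fun hpb => hp.one_lt.ne' (Nat.eq_one_of_dvd_coprimes hcop hpa hpb)
      exact hpb ((Nat.dvd_add_right hpa).mp (hsum ▸ dvd_pow_self p (by omega)))
    have hpb : ¬ p ∣ b := by
      intro hpb
      exact hpa ((Nat.dvd_add_left hpb).mp (hsum ▸ dvd_pow_self p (by omega)))
    -- the block of `p` in `ab·p^k` is `p^k = c`
    have hblock : (a * b * p ^ k).factorization p = k := by
      have hab : a * b ≠ 0 := Nat.mul_ne_zero ha.ne' hb.ne'
      rw [Nat.factorization_mul hab (pow_ne_zero _ hp.ne_zero), Finsupp.add_apply,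
        hp.factorization_pow, Finsupp.single_apply, if_pos rfl,
        Nat.factorization_eq_zero_of_not_dvd (fun hd => (hp.dvd_mul.mp hd).elim hpa hpb), zero_add]
    have key := hS {p} (Finset.singleton_nonempty p) (by simpa using hp) a b (p ^ k) habc
      (by
        intro q hq
        rw [Finset.mem_singleton] at hq
        subst hq
        rw [Real.rpow_one, hblock])
    rwa [mixed_singleton_primePow ha.ne' hb.ne' hp hpa hpb rfl hk] at key
  · -- prime-power cell ⟹ heavy at `θ = 1`: `S = {p}`, `c = p^k`
    intro h ε hε
    obtain ⟨C, hC, hcell⟩ := h ε hε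
    refine ⟨C, hC, fun S hSne hS a b c habc hheavy => ?_⟩
    obtain ⟨p, hpS⟩ := hSne
    have hp : p.Prime := hS p hpS
    have hheavyN : ∀ q ∈ S, c ≤ q ^ (a * b * c).factorization q := fun q hq => by
      have := hheavy q hq
      rw [Real.rpow_one] at this
      exact_mod_cast this
    obtain ⟨hpa, hpb, -, hceq, hk⟩ := heavyOne_structure habc hp (hheavyN p hpS)
    -- `S = {p}`
    have hSeq : S = {p} := by
      ext q
      simp only [Finset.mem_singleton]
      exact ⟨fun hq => (heavyOne_eq habc hp (hS q hq) (hheavyN p hpS) (hheavyN q hq)).symm,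
        fun hq => hq ▸ hpS⟩
    subst hSeq
    have ha : 0 < a := habc.1
    have hb : 0 < b := habc.2.1
    have key := hcell p a b (c.factorization p) hp (hceq ▸ habc)
    rw [← hceq] at key
    rw [mixed_singleton_primePow ha.ne' hb.ne' hp hpa hpb hceq hk]
    exact key

end Summit.ABC.ABC.Theorems.UniformSadicTowerFour.HeavyPlaces
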